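import Summits.ResolutionOfSingularities.ResolutionOfSingularities.Theses.Descent
import HarnessLib

/-!
# Route Descent — the assembly glue `Assembly2` (stmt-ResolutionOfSingularities-1032): pure logic

Route `ResolutionOfSingularities/Descent` (file `Summits/ResolutionOfSingularities/ResolutionOfSingularities/Theses/Descent.lean`).
Its assembly item `Assembly2` (stmt-ResolutionOfSingularities-1032) is the implication
`DescentPerfectToAll → DescentAlgclosedToPerfect → DescentReducedToIntegral → DescentThesis → ResolutionOfSingularities`:
for a prime `p`, `DescentThesis` (resolution of INTEGRAL separated finite-type schemes over ALGEBRAICALLY CLOSED fields)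
feeds `DescentReducedToIntegral` at each algebraically closed `k` (reduced schemes), then `DescentAlgclosedToPerfect`
(perfect fields), then `DescentPerfectToAll` gives `ResolutionInChar p`; the summit statement is the conjunction over the
primes (`ResolutionOfSingularities_iff`). This is the same term as the route's deciding theorem `Theses.Descent.closes`
with the hypotheses in the item's order. Nothing here bears on the truth of any crux: the three descent cruxes and the
target `DescentThesis` stay OPEN; this file only certifies the decomposition «cruxes + target ⇒ summit» in the ledger.
-/

set_option linter.dupNamespace false -- mandated namespace of this single-conjunct summit

namespace Summit.ResolutionOfSingularities.ResolutionOfSingularities.Theorems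

/-- **Assembly glue of route Descent** (stmt-ResolutionOfSingularities-1032, decl `Theses.Descent.Assembly2`):
`DescentPerfectToAll → DescentAlgclosedToPerfect → DescentReducedToIntegral → DescentThesis → ResolutionOfSingularities`.
Pure logic: for a prime `p`, chain thesis ⇒ reduced-to-integral (at algebraically closed `k`) ⇒ algebraically-closed-to-perfect
⇒ perfect-to-all, and conclude with `ResolutionOfSingularities_iff`. [folklore] -/
theorem descentAssembly2_proof : Summit.ResolutionOfSingularities.ResolutionOfSingularities.Theses.Descent.Assembly2 := by
  unfold Theses.Descent.Assembly2
  intro hPerf hAlg hRed hThesis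
  exact _root_.ResolutionOfSingularities_iff.mpr fun p hp =>
    hPerf p hp (hAlg p hp fun k _ _ _ => hRed k fun X f h1 h2 h3 h4 => hThesis p hp k X f h1 h2 h3 h4)

end Summit.ResolutionOfSingularities.ResolutionOfSingularities.Theorems
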